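import Mathlib
import Summits.HubbardSuperconductivity.HubbardSuperconductivity.Theses.KLProgramme
import HarnessLib

/-!
# Route KLProgramme — the `Assembly` item (stmt-HubbardSuperconductivity-19940), PROVED

`KLProgramme_Assembly_proof : Summit.HubbardSuperconductivity.HubbardSuperconductivity.Theses.KLProgramme.Assembly`:
`KLRegimeTwoPointLimit → H10TwoPointLimit → H1TwoPointLimitKLScaleD` — the β-regime split of the rung-R2d leaf,
pure logic: from K1 take `(U₀, a)`, feed `a` to K3 to get `(U₁, c)`, and with `min U₀ U₁` split every admissible
`β` on `β ≤ e^{a/U}` (K1's regime) versus `e^{a/U} ≤ β ≤ e^{c/U²}` (K3's regime). This is the planner's `closes`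
(Theses/KLProgramme.lean, D-0027 §2.1) restated as the standalone theorem that closes the assembly item.
-/

-- the tree's namespace `Summit.<Summit>.<Problem>.Theorems` repeats the summit name by design (D-0017)
set_option linter.dupNamespace false

namespace Summit.HubbardSuperconductivity.HubbardSuperconductivity.Theorems

open Summit.HubbardSuperconductivity.HubbardSuperconductivity.Theses.KLProgramme

/-- **The assembly of route KLProgramme**: K3 (`KLRegimeTwoPointLimit`) and K1 (`H10TwoPointLimit`) imply
the rung-R2d leaf `H1TwoPointLimitKLScaleD` (β-case split; pure logic). -/
theorem KLProgramme_Assembly_proof : Summit.HubbardSuperconductivity.HubbardSuperconductivity.Theses.KLProgramme.Assembly := by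
  intro k₃ k₁
  obtain ⟨U₀, a, hU₀, ha, H1⟩ := k₁
  obtain ⟨U₁, c, hU₁, hc, H3⟩ := k₃ a ha
  refine ⟨min U₀ U₁, c, lt_min hU₀ hU₁, hc, ?_⟩
  intro δ hδ U β hU hUle hβ hβle x y σ σ'
  by_cases hcase : β ≤ Real.exp (a / U)
  · exact H1 δ hδ U β hU (le_trans hUle (min_le_left _ _)) hβ hcase x y σ σ'
  · exact H3 δ hδ U β hU (le_trans hUle (min_le_right _ _)) (le_of_lt (not_le.mp hcase)) hβle x y σ σ'

end Summit.HubbardSuperconductivity.HubbardSuperconductivity.Theorems
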